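import Mathlib
import Summits.KontsevichZagierPeriods.KontsevichZagierPeriods.Theses.InverseLandau
import Summits.KontsevichZagierPeriods.KontsevichZagierPeriods.Theorems.InverseLandauSplitDefectLatticeLogs
import HarnessLib

/-!
# Route InverseLandau · `SplitDefectLattice` (stmt-KontsevichZagierPeriods-13873):
# the Landau log lattice, split simple-pole case

Settles the support item `SplitDefectLattice` of route InverseLandau
(`Summit.KontsevichZagierPeriods.KontsevichZagierPeriods.Theses.InverseLandau.SplitDefectLattice`)
AS STATED: for `uᵢ ∈ k[ϖ]` (`k` a field of characteristic `0`), logarithms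
`Lᵢ = log(1 − ϖuᵢ) ∈ k⟦ϖ⟧` (pinned by `Lᵢ(0) = 0`, `(1 − ϖuᵢ)Lᵢ′ = −(ϖuᵢ)′`) and coefficients
`Cᵢ ∈ k⟦ϖ⟧` algebraic over `k[ϖ]` with `Σ Cᵢ Lᵢ = 0`, the vector `C` is a `k⟦ϖ⟧`-combination of
EXACT multiplicative relations `Π (1 − ϖuᵢ)^{nᵢ} = 1` in `k(ϖ)`.

Proof (`splitDefectLattice_proof`). Work in the differential field `(k⸨ϖ⸩, d/dϖ)` with constants
`k` (helpers in `InverseLandauSplitDefectLatticeLogs.lean`). (1) An exact relation among the Landau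
units `Gᵢ = 1 − ϖuᵢ` is the same thing as the vanishing of the corresponding log-sum (no constant
of integration survives: `Gᵢ(0) = 1`, `Lᵢ(0) = 0`), so the relation lattice `Λ ⊆ ℤ^m` is
saturated and `ℤ^m/Λ` is finitely generated torsion-free, hence free
(`Module.basisOfFiniteTypeTorsionFree'`). (2) Lift a basis to rows `Mⱼ ∈ ℤ^m`; the logarithms
`yⱼ = Σᵢ Mⱼᵢ Lᵢ` admit no non-trivial integer relation modulo constants, so by Ax's theorem
(Ax 1971, Thm. 3, proved in the tree) they are linearly independent over the power series
algebraic over `k[ϖ]`. (3) Writing `e_q = nv_q + Σⱼ b_qj Mⱼ` with `nv_q ∈ Λ` turns `Σ C_q L_q = 0`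
into `Σⱼ (Σ_q b_qj C_q) yⱼ = 0`, whence `Σ_q b_qj C_q = 0` and `Cᵢ = Σ_q nv_qᵢ C_q`: the witnesses
are `s = m`, `nv`, `c = C`. The relations are transported to `k(ϖ)` along the injection
`k(ϖ) → k⸨ϖ⸩` (`IsFractionRing.lift`).

References: J. Ax, *On Schanuel's conjectures*, Ann. of Math. 93 (1971), Thm. 3; J. Ayoub, *Une
version relative de la conjecture des périodes de Kontsevich–Zagier* (motivation of the route).
-/

noncomputable section

open scoped LaurentSeries
open HahnSeries

namespace Summit.KontsevichZagierPeriods.InverseLandau.SplitDefect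

open Literature.RingTheory.PowerSeries (algebraMap_laurentSeries_apply derivative_coe_powerSeries
  derivative_eq_zero_iff_mem_range_algebraMap)

variable {k : Type*} [Field k]

section Main

open Polynomial (aeval)

/-- The coercion `k[X] → k⟦X⟧ → k⸨X⸩` is evaluation at `X = single 1 1`. [folklore] -/
theorem coe_coe_eq_aeval (p : Polynomial k) :
    ((p : PowerSeries k) : k⸨X⸩) = aeval (single 1 (1 : k) : k⸨X⸩) p := by
  have h : (ofPowerSeries ℤ k).comp (Polynomial.coeToPowerSeries.ringHom (R := k)) =
      (aeval (single 1 (1 : k) : k⸨X⸩)).toRingHom := by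
    refine Polynomial.ringHom_ext (fun a => ?_) ?_
    · rw [RingHom.comp_apply, Polynomial.coeToPowerSeries.ringHom_apply, Polynomial.coe_C,
        ofPowerSeries_C, AlgHom.toRingHom_eq_coe, RingHom.coe_coe, Polynomial.aeval_C,
        algebraMap_laurentSeries_apply]
    · rw [RingHom.comp_apply, Polynomial.coeToPowerSeries.ringHom_apply, Polynomial.coe_X,
        ofPowerSeries_X, AlgHom.toRingHom_eq_coe, RingHom.coe_coe, Polynomial.aeval_X]
  exact RingHom.congr_fun h p

/-- Images of power series algebraic over `k[X]` (in the sense of the route statement: a non-zero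
`R ∈ k[X][Y]` with `R(C) = 0`) are algebraic over the subalgebra `k[X] ⊆ k⸨X⸩`. [folklore] -/
theorem isAlgebraic_adjoin_coe {C : PowerSeries k}
    (hC : ∃ R : Polynomial (Polynomial k), R ≠ 0 ∧
      Polynomial.eval₂ (Polynomial.coeToPowerSeries.ringHom (R := k)) C R = 0) :
    IsAlgebraic (Algebra.adjoin k ({single 1 1} : Set k⸨X⸩)) ((C : PowerSeries k) : k⸨X⸩) := by
  obtain ⟨R, hR0, hR⟩ := hC
  set x₁ : k⸨X⸩ := single 1 1 with hx₁
  set A₁ := Algebra.adjoin k ({x₁} : Set k⸨X⸩) with hA₁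
  set f : Polynomial k →+* A₁ :=
    (aeval (⟨x₁, Algebra.self_mem_adjoin_singleton k x₁⟩ : A₁)).toRingHom with hf
  have hfval : ∀ p, ((f p : A₁) : k⸨X⸩) = ((p : PowerSeries k) : k⸨X⸩) := fun p => by
    rw [coe_coe_eq_aeval]
    show A₁.val (aeval (⟨x₁, Algebra.self_mem_adjoin_singleton k x₁⟩ : A₁) p) =
      aeval (single 1 (1 : k) : k⸨X⸩) p
    rw [← Polynomial.aeval_algHom_apply]
    rfl
  have hfinj : Function.Injective f := fun p₁ p₂ h => by
    have h' := congrArg (fun a : A₁ => (a : k⸨X⸩)) h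
    simp only [hfval] at h'
    exact Polynomial.coe_injective k (ofPowerSeries_injective h')
  refine ⟨R.map f, (Polynomial.map_ne_zero_iff hfinj).2 hR0, ?_⟩
  rw [Polynomial.aeval_def, Polynomial.eval₂_map]
  have hcomp : (algebraMap A₁ k⸨X⸩).comp f =
      (ofPowerSeries ℤ k).comp (Polynomial.coeToPowerSeries.ringHom (R := k)) :=
    RingHom.ext fun p => hfval p
  rw [hcomp, ← Polynomial.hom_eval₂, hR, map_zero]

variable [CharZero k]

/-- **Settles stmt-KontsevichZagierPeriods-13873 (`SplitDefectLattice`, route InverseLandau):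
the Landau log lattice, split simple-pole case.** If `Σᵢ Cᵢ log(1 − ϖuᵢ) = 0` in `k⟦ϖ⟧` with
`Cᵢ` algebraic over `k[ϖ]`, then the coefficient vector `C` is a `k⟦ϖ⟧`-combination of EXACT
multiplicative relations among the Landau functions `gᵢ = 1 − ϖuᵢ`. Proof: in the differential
field `(k⸨ϖ⸩, d/dϖ)` (constants `k`) an exact relation `Π gᵢ^{nᵢ} = 1` is the same as
`Σ nᵢ Lᵢ = 0` (no constant of integration survives: everything is `≡ 1` resp. `≡ 0` at `ϖ = 0`),
so the relation lattice `Λ` is saturated and `ℤ^m/Λ` is free; lifting a basis to rows `Mⱼ`,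
the logarithms `yⱼ = Σᵢ Mⱼᵢ Lᵢ` admit no integer relation modulo constants, hence by Ax's
theorem (`Ax1971.add_rank_le_trdeg_of_field`, one derivation) are linearly independent over the
power series algebraic over `k[ϖ]`; writing `eᵢ = nvᵢ + Σⱼ bᵢⱼ Mⱼ` with `nvᵢ ∈ Λ` gives
`Σᵢ bᵢⱼ Cᵢ = 0` and `C = Σ_q C_q · nv_q`. [cite: Ax1971, Thm. 3] -/
theorem splitDefectLattice_proof :
    Summit.KontsevichZagierPeriods.KontsevichZagierPeriods.Theses.InverseLandau.SplitDefectLattice := by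
  intro k _ _ m u C L hCalg hL hsum
  classical
  -- the differential field `k⸨X⸩`
  haveI : CharZero k⸨X⸩ :=
    charZero_of_injective_algebraMap (algebraMap k k⸨X⸩).injective
  obtain ⟨D, hD⟩ := exists_algDerivation_eq_derivative k
  have hC : ∀ x : k⸨X⸩, D x = 0 → x ∈ Set.range (algebraMap k k⸨X⸩) := fun x hx =>
    (derivative_eq_zero_iff_mem_range_algebraMap x).1 (by rw [← hD]; exact hx)
  -- the Landau units `Gᵢ = 1 - X uᵢ`
  obtain ⟨G, hGdef⟩ : ∃ G : Fin m → PowerSeries k,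
      ∀ i, G i = ((1 - Polynomial.X * u i : Polynomial k) : PowerSeries k) := ⟨_, fun _ => rfl⟩
  have hG : ∀ i, G i = 1 - PowerSeries.X * (u i : PowerSeries k) := fun i => by
    rw [hGdef, ← Polynomial.coeToPowerSeries.ringHom_apply, map_sub, map_mul, map_one,
      Polynomial.coeToPowerSeries.ringHom_apply, Polynomial.coeToPowerSeries.ringHom_apply,
      Polynomial.coe_X]
  have hG1 : ∀ i, PowerSeries.constantCoeff (G i) = 1 := fun i => by
    rw [hG i, map_sub, map_mul, PowerSeries.constantCoeff_X, zero_mul, sub_zero, map_one]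
  have hGne : ∀ i, ((G i : PowerSeries k) : k⸨X⸩) ≠ 0 :=
    fun i => coe_ne_zero_of_constantCoeff_eq_one (hG1 i)
  have hexp : ∀ i, D ((G i : PowerSeries k) : k⸨X⸩) =
      ((G i : PowerSeries k) : k⸨X⸩) * D ((L i : PowerSeries k) : k⸨X⸩) := by
    intro i
    have hd : PowerSeries.derivative k (G i) =
        -PowerSeries.derivative k (PowerSeries.X * (u i : PowerSeries k)) := by
      rw [hG i, map_sub, (PowerSeries.derivative k).map_one_eq_zero, zero_sub]
    rw [hD, hD, derivative_coe_powerSeries, derivative_coe_powerSeries, ← PowerSeries.coe_mul,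
      hd, ← (hL i).2, hG i]
  -- the exact relation lattice `Λ`
  obtain ⟨Λ, hΛ⟩ : ∃ Λ : Submodule ℤ (Fin m → ℤ),
      ∀ N, N ∈ Λ ↔ ∏ i, ((G i : PowerSeries k) : k⸨X⸩) ^ N i = 1 := by
    refine ⟨{ carrier := {N | ∏ i, ((G i : PowerSeries k) : k⸨X⸩) ^ N i = 1}
              add_mem' := ?_, zero_mem' := ?_, smul_mem' := ?_ }, fun N => Iff.rfl⟩
    · intro a b ha hb
      simp only [Set.mem_setOf_eq, Pi.add_apply] at ha hb ⊢
      calc ∏ i, ((G i : PowerSeries k) : k⸨X⸩) ^ (a i + b i)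
          = (∏ i, ((G i : PowerSeries k) : k⸨X⸩) ^ a i) *
              ∏ i, ((G i : PowerSeries k) : k⸨X⸩) ^ b i := by
            rw [← Finset.prod_mul_distrib]
            exact Finset.prod_congr rfl fun i _ => zpow_add₀ (hGne i) _ _
        _ = 1 := by rw [ha, hb, one_mul]
    · simp
    · intro c a ha
      simp only [Set.mem_setOf_eq, Pi.smul_apply, smul_eq_mul] at ha ⊢
      calc ∏ i, ((G i : PowerSeries k) : k⸨X⸩) ^ (c * a i)
          = (∏ i, ((G i : PowerSeries k) : k⸨X⸩) ^ a i) ^ c := by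
            rw [← Finset.prod_zpow]
            exact Finset.prod_congr rfl fun i _ => by rw [mul_comm, zpow_mul]
        _ = 1 := by rw [ha, one_zpow]
  -- relations kill log-sums and conversely (no constant of integration at the Tate point)
  have hcoeS : ∀ N : Fin m → ℤ, (((∑ i, (N i : PowerSeries k) * L i : PowerSeries k)) : k⸨X⸩) =
      ∑ i, (N i : k⸨X⸩) * ((L i : PowerSeries k) : k⸨X⸩) := fun N => by
    rw [map_sum]
    exact Finset.sum_congr rfl fun i _ => by rw [map_mul, map_intCast]
  have hrel_log : ∀ N : Fin m → ℤ, N ∈ Λ →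
      (∑ i, (N i : k⸨X⸩) * ((L i : PowerSeries k) : k⸨X⸩)) = 0 := fun N hN => by
    rw [← hcoeS, logSum_eq_zero_of_prod_zpow_eq_one D hD G L hG1 (fun i => (hL i).1) hexp N
      ((hΛ N).1 hN), map_zero]
  have hlog_rel : ∀ N : Fin m → ℤ,
      (∑ i, (N i : k⸨X⸩) * ((L i : PowerSeries k) : k⸨X⸩)) = 0 → N ∈ Λ := fun N hN =>
    (hΛ N).2 (prod_zpow_eq_one_of_derivation_eq_zero D hD G hG1 _ hexp N (by rw [hN, map_zero]))
  -- `Λ` is saturated, so the quotient is torsion-free, hence free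
  have hsatΛ : ∀ (c : ℤ) (v : Fin m → ℤ), c ≠ 0 → c • v ∈ Λ → v ∈ Λ := by
    intro c v hc hcv
    apply hlog_rel
    have h := hrel_log _ hcv
    have : (∑ i, (((c • v) i : ℤ) : k⸨X⸩) * ((L i : PowerSeries k) : k⸨X⸩)) =
        (c : k⸨X⸩) * ∑ i, (v i : k⸨X⸩) * ((L i : PowerSeries k) : k⸨X⸩) := by
      rw [Finset.mul_sum]
      exact Finset.sum_congr rfl fun i _ => by
        simp only [Pi.smul_apply, smul_eq_mul, Int.cast_mul]; ring
    rw [this] at h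
    exact (mul_eq_zero.1 h).resolve_left (Int.cast_ne_zero.2 hc)
  haveI : Module.Finite ℤ ((Fin m → ℤ) ⧸ Λ) :=
    Module.Finite.of_surjective Λ.mkQ (Submodule.mkQ_surjective Λ)
  haveI : Module.IsTorsionFree ℤ ((Fin m → ℤ) ⧸ Λ) := Module.IsTorsionFree.of_smul_eq_zero (by
    intro c x hcx
    obtain ⟨v, rfl⟩ := Submodule.Quotient.mk_surjective Λ x
    have hcx' : (Submodule.Quotient.mk (c • v) : (Fin m → ℤ) ⧸ Λ) = 0 := by
      rw [Submodule.Quotient.mk_smul]; exact hcx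
    rw [Submodule.Quotient.mk_eq_zero] at hcx'
    by_cases hc : c = 0
    · exact Or.inl hc
    · exact Or.inr ((Submodule.Quotient.mk_eq_zero Λ).2 (hsatΛ c v hc hcx')))
  obtain ⟨t, B⟩ := Module.basisOfFiniteTypeTorsionFree' (R := ℤ) (M := (Fin m → ℤ) ⧸ Λ)
  obtain ⟨M, hM⟩ : ∃ M : Fin t → Fin m → ℤ,
      ∀ j, (Submodule.Quotient.mk (M j) : (Fin m → ℤ) ⧸ Λ) = B j :=
    ⟨fun j => (Submodule.Quotient.mk_surjective Λ (B j)).choose,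
      fun j => (Submodule.Quotient.mk_surjective Λ (B j)).choose_spec⟩
  obtain ⟨b, hb⟩ : ∃ b : Fin m → Fin t → ℤ,
      ∀ q j, b q j = B.repr (Submodule.Quotient.mk (Pi.single q 1)) j := ⟨_, fun _ _ => rfl⟩
  obtain ⟨nv, hnv⟩ : ∃ nv : Fin m → Fin m → ℤ,
      ∀ q, nv q = Pi.single q 1 - ∑ j, b q j • M j := ⟨_, fun _ => rfl⟩
  have hnvΛ : ∀ q, nv q ∈ Λ := by
    intro q
    have h : Λ.mkQ (Pi.single q 1 - ∑ j, b q j • M j) = 0 := by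
      rw [map_sub, map_sum]
      simp only [map_smul, Submodule.mkQ_apply, hM, hb]
      rw [B.sum_repr (Submodule.Quotient.mk (Pi.single q 1))]
      exact sub_self _
    rw [Submodule.mkQ_apply, Submodule.Quotient.mk_eq_zero] at h
    rw [hnv]; exact h
  have hMind : ∀ a : Fin t → ℤ, (∑ j, a j • M j) ∈ Λ → a = 0 := by
    intro a ha
    rw [← Submodule.Quotient.mk_eq_zero, ← Submodule.mkQ_apply, map_sum] at ha
    simp only [map_smul, Submodule.mkQ_apply, hM] at ha
    funext j
    exact Fintype.linearIndependent_iff.1 B.linearIndependent a ha j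
  -- the abstract independence lemma applies to `yⱼ = Σᵢ Mⱼᵢ Lᵢ`
  have hzA : ∀ i, ((G i : PowerSeries k) : k⸨X⸩) ∈
      Algebra.adjoin k ({single 1 1} : Set k⸨X⸩) := fun i => by
    rw [hGdef, coe_coe_eq_aeval]
    exact Polynomial.aeval_mem_adjoin_singleton k _
  have hsat : ∀ q : Fin t → ℤ, D (∑ j, (q j : k⸨X⸩) *
      ∑ i, (M j i : k⸨X⸩) * ((L i : PowerSeries k) : k⸨X⸩)) = 0 → q = 0 := by
    intro q hq
    apply hMind q
    have heq : (∑ j, q j • M j) = fun i => ∑ j, q j * M j i := by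
      funext i; simp [Finset.sum_apply]
    rw [heq]
    refine hlog_rel _ ?_
    have hre : (∑ i, ((∑ j, q j * M j i : ℤ) : k⸨X⸩) * ((L i : PowerSeries k) : k⸨X⸩)) =
        ∑ j, (q j : k⸨X⸩) * ∑ i, (M j i : k⸨X⸩) * ((L i : PowerSeries k) : k⸨X⸩) := by
      rw [sum_mul_logSum_eq]
      push_cast
      rfl
    have hq' := prod_zpow_eq_one_of_derivation_eq_zero D hD G hG1 _ hexp
      (fun i => ∑ j, q j * M j i) (by rw [hre]; exact hq)
    exact hrel_log _ ((hΛ _).2 hq')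
  have ha : ∀ j, IsAlgebraic (Algebra.adjoin k ({single 1 1} : Set k⸨X⸩))
      (∑ q, (b q j : k⸨X⸩) * ((C q : PowerSeries k) : k⸨X⸩)) := by
    intro j
    haveI : IsDomain (Algebra.adjoin k ({single 1 1} : Set k⸨X⸩)) := inferInstance
    show (∑ q, (b q j : k⸨X⸩) * ((C q : PowerSeries k) : k⸨X⸩)) ∈
      Subalgebra.algebraicClosure (Algebra.adjoin k ({single 1 1} : Set k⸨X⸩)) k⸨X⸩
    exact sum_mem fun q _ => mul_mem (intCast_mem _ (b q j)) (isAlgebraic_adjoin_coe (hCalg q))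
  -- the relation `Σⱼ (Σ_q b_qj C_q) yⱼ = Σ_q C_q L_q = 0`
  have hLsum : (∑ q, ((C q : PowerSeries k) : k⸨X⸩) * ((L q : PowerSeries k) : k⸨X⸩)) = 0 := by
    have := congrArg (ofPowerSeries ℤ k) hsum
    rw [map_sum, map_zero] at this
    rw [← this]
    exact Finset.sum_congr rfl fun q _ => (map_mul _ _ _).symm
  have hbM : ∀ q i, (∑ j, (b q j : k⸨X⸩) * (M j i : k⸨X⸩)) =
      ((Pi.single q (1 : ℤ) : Fin m → ℤ) i : k⸨X⸩) - (nv q i : k⸨X⸩) := by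
    intro q i
    have : nv q i = (Pi.single q (1 : ℤ) : Fin m → ℤ) i - ∑ j, b q j * M j i := by
      rw [hnv]; simp [Finset.sum_apply]
    rw [this]; push_cast; ring
  have hsingle : ∀ (q : Fin m) (f : Fin m → k⸨X⸩),
      (∑ i, ((Pi.single q (1 : ℤ) : Fin m → ℤ) i : k⸨X⸩) * f i) = f q := by
    intro q f
    rw [Finset.sum_eq_single q (fun i _ hi => by simp [hi]) (by simp)]
    simp
  have hy_b : ∀ q, (∑ j, (b q j : k⸨X⸩) *
      ∑ i, (M j i : k⸨X⸩) * ((L i : PowerSeries k) : k⸨X⸩)) = ((L q : PowerSeries k) : k⸨X⸩) := by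
    intro q
    rw [sum_mul_logSum_eq]
    simp only [hbM, sub_mul, Finset.sum_sub_distrib]
    rw [hsingle, hrel_log (nv q) (hnvΛ q), sub_zero]
  have hrel : (∑ j, (∑ q, (b q j : k⸨X⸩) * ((C q : PowerSeries k) : k⸨X⸩)) *
      ∑ i, (M j i : k⸨X⸩) * ((L i : PowerSeries k) : k⸨X⸩)) = 0 := by
    calc (∑ j, (∑ q, (b q j : k⸨X⸩) * ((C q : PowerSeries k) : k⸨X⸩)) *
          ∑ i, (M j i : k⸨X⸩) * ((L i : PowerSeries k) : k⸨X⸩))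
        = ∑ j, ∑ q, ((b q j : k⸨X⸩) * ((C q : PowerSeries k) : k⸨X⸩)) *
            ∑ i, (M j i : k⸨X⸩) * ((L i : PowerSeries k) : k⸨X⸩) :=
          Finset.sum_congr rfl fun j _ => Finset.sum_mul _ _ _
      _ = ∑ q, ∑ j, ((b q j : k⸨X⸩) * ((C q : PowerSeries k) : k⸨X⸩)) *
            ∑ i, (M j i : k⸨X⸩) * ((L i : PowerSeries k) : k⸨X⸩) := Finset.sum_comm
      _ = ∑ q, ((C q : PowerSeries k) : k⸨X⸩) * ∑ j, (b q j : k⸨X⸩) *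
            ∑ i, (M j i : k⸨X⸩) * ((L i : PowerSeries k) : k⸨X⸩) := by
          refine Finset.sum_congr rfl fun q _ => ?_
          rw [Finset.mul_sum]
          exact Finset.sum_congr rfl fun j _ => by ring
      _ = ∑ q, ((C q : PowerSeries k) : k⸨X⸩) * ((L q : PowerSeries k) : k⸨X⸩) :=
          Finset.sum_congr rfl fun q _ => by rw [hy_b q]
      _ = 0 := hLsum
  have hzero := eq_zero_of_sum_mul_logSum_eq_zero D hC (fun i => ((G i : PowerSeries k) : k⸨X⸩))
    (fun i => ((L i : PowerSeries k) : k⸨X⸩)) hGne hexp (single 1 1) hzA M hsat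
    (fun j => ∑ q, (b q j : k⸨X⸩) * ((C q : PowerSeries k) : k⸨X⸩)) ha hrel
  -- conclusion: `s = m`, the relations `nv_q = e_q - Σⱼ b_qj Mⱼ`, coefficients `c = C`
  refine ⟨m, nv, C, fun q => ?_, fun i => ?_⟩
  · have hinj : Function.Injective (algebraMap (Polynomial k) k⸨X⸩) :=
      Polynomial.algebraMap_hahnSeries_injective ℤ
    apply (IsFractionRing.lift (K := RatFunc k) hinj).injective
    rw [map_prod, map_one, ← (hΛ (nv q)).1 (hnvΛ q)]
    refine Finset.prod_congr rfl fun i _ => ?_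
    rw [map_zpow₀, ← RatFunc.algebraMap_X, ← map_mul,
      ← map_one (algebraMap (Polynomial k) (RatFunc k)), ← map_sub,
      IsFractionRing.lift_algebraMap, Polynomial.algebraMap_hahnSeries_apply (Γ := ℤ), hGdef]
  · refine ofPowerSeries_injective (Γ := ℤ) ?_
    show ((C i : PowerSeries k) : k⸨X⸩) = ((∑ q, (nv q i : PowerSeries k) * C q : PowerSeries k) : k⸨X⸩)
    rw [map_sum]
    simp only [map_mul, map_intCast]
    have hnvK : ∀ q, (nv q i : k⸨X⸩) = ((Pi.single q (1 : ℤ) : Fin m → ℤ) i : k⸨X⸩) -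
        ∑ j, (b q j : k⸨X⸩) * (M j i : k⸨X⸩) := fun q => by rw [hbM]; ring
    simp only [hnvK, sub_mul, Finset.sum_sub_distrib, Finset.sum_mul]
    have hsingle' : ∀ f : Fin m → k⸨X⸩,
        (∑ q, ((Pi.single q (1 : ℤ) : Fin m → ℤ) i : k⸨X⸩) * f q) = f i := by
      intro f
      rw [Finset.sum_eq_single i (fun q _ hq => by simp [Ne.symm hq]) (by simp)]
      simp
    rw [hsingle']
    have h0 : (∑ q, ∑ j, (b q j : k⸨X⸩) * (M j i : k⸨X⸩) * ((C q : PowerSeries k) : k⸨X⸩)) = 0 := by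
      rw [Finset.sum_comm]
      refine Finset.sum_eq_zero fun j _ => ?_
      have : (∑ q, (b q j : k⸨X⸩) * (M j i : k⸨X⸩) * ((C q : PowerSeries k) : k⸨X⸩)) =
          (M j i : k⸨X⸩) * ∑ q, (b q j : k⸨X⸩) * ((C q : PowerSeries k) : k⸨X⸩) := by
        rw [Finset.mul_sum]; exact Finset.sum_congr rfl fun q _ => by ring
      rw [this, hzero j, mul_zero]
    rw [h0, sub_zero]

end Main

end Summit.KontsevichZagierPeriods.InverseLandau.SplitDefect

end
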